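import Summits.AtomisticToContinuum.Crystallization.Theorems.ExcessDecayLiouvilleAffineFieldsBasic

/-!
# Route `ExcessDecayLiouville`: affine fields on the site set — norm equivalence on balls

Campanato bookkeeping for the excess-decay argument of item `ExcessDecay` (stmt-AtomisticToContinuum-9334),
harmonic-replacement architecture.  An AFFINE FIELD on the sites of an admissible datum is
`aff (t m + A z) = a m + B (t m + A z − c₀)` (two sublattice translations `a 0, a 1`, ONE linear part `B`,
centre the site `c₀ = t 0 + A z₀`).  Its local `ℓ²`-mass on a ball, `Σ'_p ‖aff p‖² · 𝟙[dist p c₀ ≤ ρ]`,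
controls its coefficients (the sup-type size of an affine field on the ball is controlled by its `ℓ²`-average):

* `norm_t_sub_t0_le` : `‖t m − t 0‖ ≤ 11/10`;
* `lattice_image_sq_le_localMass` : `(2n+1)³ ‖N • B(Aτ)‖² ≤ 4 · mass` for `τ ∈ Λ₀`, `(199/200)(4n + N‖τ‖) ≤ ρ`;
* `translation_sq_le_localMass` : `(2n+1)³ ‖a m‖² ≤ 2 · mass + 2 (2n+1)³ ρ² ‖B‖²`;
* `affine_coeff_sq_le_localMass` : for `ρ ≥ 16`,
  `ρ² ‖B‖² + ‖a 0‖² + ‖a 1‖² ≤ 2 ^ 33 / ρ ^ 3 · Σ'_p ‖aff p‖² 𝟙[dist p c₀ ≤ ρ]`.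

All `[folklore]`; helper lemmas, nothing here closes an item.
-/

noncomputable section

namespace Summit.AtomisticToContinuum.Crystallization.Theorems.ExcessDecayLiouville

open scoped BigOperators Topology InnerProductSpace RealInnerProductSpace Classical
open Literature.MathematicalPhysics.StatisticalMechanics
open Summit.AtomisticToContinuum.Crystallization.Theorems.PhononStabilityNegative
open Summit.AtomisticToContinuum.Crystallization.Theorems

-- the three lattice generators and the lattice vector with integer coordinates (notations, not definitions)
local notation "𝐮₁" => (triangularVec₁ 1 : EuclideanSpace ℝ (Fin 3))
local notation "𝐮₂" => (triangularVec₂ 1 : EuclideanSpace ℝ (Fin 3))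
local notation "𝐰₃" => (layerNormal (2 * Real.sqrt (2 / 3)) : EuclideanSpace ℝ (Fin 3))
local notation "𝐳[" i ", " j ", " k "]" =>
  (((i : ℤ) : ℝ) • (triangularVec₁ 1 : EuclideanSpace ℝ (Fin 3)) + ((j : ℤ) : ℝ) • triangularVec₂ 1 +
    ((k : ℤ) : ℝ) • layerNormal (2 * Real.sqrt (2 / 3)))

section Affine

variable {t : Fin 2 → (EuclideanSpace ℝ (Fin 3))} {A : (EuclideanSpace ℝ (Fin 3)) →L[ℝ] (EuclideanSpace ℝ (Fin 3))}

/-- The sublattice translations differ by at most `11/10` (`m = 0`: trivially; `m = 1`: `norm_t_sub_t_le`). [folklore] -/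
theorem norm_t_sub_t0_le (hA : Adm₀ A) (hI : Inner₀ t A) (m : Fin 2) : ‖t m - t 0‖ ≤ 11 / 10 := by
  fin_cases m
  · norm_num
  · exact norm_t_sub_t_le hA hI

/-- **Linear part from the local mass, one generator**: for an affine field `aff` (translations `a`,
linear part `B`, centre the site `c₀ = t 0 + A z₀`), a lattice vector `τ` and `n, N : ℕ` with
`(199/200)(4n + N‖τ‖) ≤ ρ`,
`(2n+1)³ ‖N • B (A τ)‖² ≤ 4 · Σ'_p ‖aff p‖² 𝟙[dist p c₀ ≤ ρ]`. [folklore] -/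
theorem lattice_image_sq_le_localMass (hA : Adm₀ A) (hI : Inner₀ t A)
    {aff : (EuclideanSpace ℝ (Fin 3)) → (EuclideanSpace ℝ (Fin 3))} {a : Fin 2 → EuclideanSpace ℝ (Fin 3)}
    {B : (EuclideanSpace ℝ (Fin 3)) →L[ℝ] (EuclideanSpace ℝ (Fin 3))} {z₀ : EuclideanSpace ℝ (Fin 3)} (hz₀ : z₀ ∈ Λ₀)
    (haff : ∀ (m : Fin 2) (z : EuclideanSpace ℝ (Fin 3)), z ∈ Λ₀ →
      aff (t m + A z) = a m + B (t m + A z - (t 0 + A z₀)))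
    {τ : EuclideanSpace ℝ (Fin 3)} (hτ : τ ∈ Λ₀) {n N : ℕ} {ρ : ℝ}
    (hρ : 199 / 200 * (4 * n + N * ‖τ‖) ≤ ρ) :
    ((2 * n + 1) ^ 3 : ℝ) * ‖(N : ℝ) • B (A τ)‖ ^ 2 ≤
      4 * ∑' p : Sites₀ t A, ‖aff p‖ ^ 2 * (if dist (p : EuclideanSpace ℝ (Fin 3)) (t 0 + A z₀) ≤ ρ then (1 : ℝ) else 0) := by
  classical
  set box := (Finset.Icc (-(n : ℤ)) n) ×ˢ (Finset.Icc (-(n : ℤ)) n) ×ˢ (Finset.Icc (-(n : ℤ)) n) with hbox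
  set φ : ℤ × ℤ × ℤ → EuclideanSpace ℝ (Fin 3) := fun ijk => t 0 + A (z₀ + 𝐳[ijk.1, ijk.2.1, ijk.2.2]) with hφ
  set φ' : ℤ × ℤ × ℤ → EuclideanSpace ℝ (Fin 3) :=
    fun ijk => t 0 + A (z₀ + 𝐳[ijk.1, ijk.2.1, ijk.2.2] + (N : ℝ) • τ) with hφ'
  have hNτ : (N : ℝ) • τ ∈ Λ₀ := nsmul_mem_Λ₀ hτ N
  have hn0 : (0 : ℝ) ≤ n := Nat.cast_nonneg _
  have hN0 : (0 : ℝ) ≤ N := Nat.cast_nonneg _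
  -- termwise: the difference of the two values is `N • B (A τ)`
  have hterm : ∀ ijk ∈ box, ‖(N : ℝ) • B (A τ)‖ ^ 2 ≤ 2 * ‖aff (φ' ijk)‖ ^ 2 + 2 * ‖aff (φ ijk)‖ ^ 2 := by
    intro ijk _
    have hz : z₀ + 𝐳[ijk.1, ijk.2.1, ijk.2.2] ∈ Λ₀ :=
      hcpLiouvilleLam_add_mem hz₀ (latticeVec_mem_Λ₀ _ _ _)
    have hz' : z₀ + 𝐳[ijk.1, ijk.2.1, ijk.2.2] + (N : ℝ) • τ ∈ Λ₀ := hcpLiouvilleLam_add_mem hz hNτ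
    have h1 := haff 0 _ hz
    have h2 := haff 0 _ hz'
    have hdiff : aff (φ' ijk) - aff (φ ijk) = (N : ℝ) • B (A τ) := by
      rw [hφ, hφ', h1, h2]
      simp only [map_add, map_sub, map_smul]
      abel
    rw [← hdiff]
    have := norm_sub_le (aff (φ' ijk)) (aff (φ ijk))
    have hsq : ‖aff (φ' ijk) - aff (φ ijk)‖ ^ 2 ≤ (‖aff (φ' ijk)‖ + ‖aff (φ ijk)‖) ^ 2 :=
      pow_le_pow_left₀ (norm_nonneg _) this 2
    nlinarith [hsq, sq_nonneg (‖aff (φ' ijk)‖ - ‖aff (φ ijk)‖)]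
  -- geometry of the two families
  have hmemS : ∀ ijk ∈ box, φ ijk ∈ Sites₀ t A := fun ijk _ =>
    ⟨0, _, hcpLiouvilleLam_add_mem hz₀ (latticeVec_mem_Λ₀ _ _ _), rfl⟩
  have hmemS' : ∀ ijk ∈ box, φ' ijk ∈ Sites₀ t A := fun ijk _ =>
    ⟨0, _, hcpLiouvilleLam_add_mem (hcpLiouvilleLam_add_mem hz₀ (latticeVec_mem_Λ₀ _ _ _)) hNτ, rfl⟩
  have hdist : ∀ ijk ∈ box, dist (φ ijk) (t 0 + A z₀) ≤ ρ := by
    intro ijk hijk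
    obtain ⟨hi, hj, hk⟩ := mem_box_iff.1 hijk
    have hzn := norm_latticeBox_le hi hj hk
    rw [hφ, dist_eq_norm]
    have : t 0 + A (z₀ + 𝐳[ijk.1, ijk.2.1, ijk.2.2]) - (t 0 + A z₀) = A 𝐳[ijk.1, ijk.2.1, ijk.2.2] := by
      rw [map_add]; abel
    rw [this]
    have h1 := norm_apply_le_of_adm₀ hA 𝐳[ijk.1, ijk.2.1, ijk.2.2]
    have h2 : 199 / 200 * ‖𝐳[ijk.1, ijk.2.1, ijk.2.2]‖ ≤ 199 / 200 * (4 * n) := by gcongr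
    have h3 : 0 ≤ (N : ℝ) * ‖τ‖ := mul_nonneg hN0 (norm_nonneg _)
    linarith
  have hdist' : ∀ ijk ∈ box, dist (φ' ijk) (t 0 + A z₀) ≤ ρ := by
    intro ijk hijk
    obtain ⟨hi, hj, hk⟩ := mem_box_iff.1 hijk
    have hzn := norm_latticeBox_le hi hj hk
    rw [hφ', dist_eq_norm]
    have : t 0 + A (z₀ + 𝐳[ijk.1, ijk.2.1, ijk.2.2] + (N : ℝ) • τ) - (t 0 + A z₀) =
        A (𝐳[ijk.1, ijk.2.1, ijk.2.2] + (N : ℝ) • τ) := by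
      simp only [map_add]; abel
    rw [this]
    have h1 := norm_apply_le_of_adm₀ hA (𝐳[ijk.1, ijk.2.1, ijk.2.2] + (N : ℝ) • τ)
    have h2 : ‖𝐳[ijk.1, ijk.2.1, ijk.2.2] + (N : ℝ) • τ‖ ≤ 4 * n + N * ‖τ‖ := by
      refine (norm_add_le _ _).trans ?_
      rw [norm_smul, Real.norm_eq_abs, abs_of_nonneg hN0]
      linarith
    have h3 : 199 / 200 * ‖𝐳[ijk.1, ijk.2.1, ijk.2.2] + (N : ℝ) • τ‖ ≤ 199 / 200 * (4 * n + N * ‖τ‖) := by gcongr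
    linarith
  have hinj : Set.InjOn φ box := by
    intro x _ y _ h
    have h' : A (z₀ + 𝐳[x.1, x.2.1, x.2.2]) = A (z₀ + 𝐳[y.1, y.2.1, y.2.2]) := add_left_cancel h
    have h'' := add_left_cancel (injective_of_adm₀ hA h')
    exact latticeBox_injective h''
  have hinj' : Set.InjOn φ' box := by
    intro x _ y _ h
    have h' : A (z₀ + 𝐳[x.1, x.2.1, x.2.2] + (N : ℝ) • τ) = A (z₀ + 𝐳[y.1, y.2.1, y.2.2] + (N : ℝ) • τ) :=
      add_left_cancel h
    have h2 : z₀ + 𝐳[x.1, x.2.1, x.2.2] + (N : ℝ) • τ = z₀ + 𝐳[y.1, y.2.1, y.2.2] + (N : ℝ) • τ :=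
      injective_of_adm₀ hA h'
    have h3 : 𝐳[x.1, x.2.1, x.2.2] = 𝐳[y.1, y.2.1, y.2.2] := add_left_cancel (add_right_cancel h2)
    exact latticeBox_injective h3
  have hS := sum_le_localMass hA hI aff (t 0 + A z₀) ρ box φ hmemS hdist hinj
  have hS' := sum_le_localMass hA hI aff (t 0 + A z₀) ρ box φ' hmemS' hdist' hinj'
  have hcard : ((2 * n + 1) ^ 3 : ℝ) = ∑ ijk ∈ box, (1 : ℝ) := by
    rw [Finset.sum_const, nsmul_eq_mul, mul_one, hbox, card_latticeBox]; push_cast; ring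
  calc ((2 * n + 1) ^ 3 : ℝ) * ‖(N : ℝ) • B (A τ)‖ ^ 2
      = ∑ ijk ∈ box, ‖(N : ℝ) • B (A τ)‖ ^ 2 := by rw [Finset.sum_const, nsmul_eq_mul, hbox, card_latticeBox]; push_cast; ring
    _ ≤ ∑ ijk ∈ box, (2 * ‖aff (φ' ijk)‖ ^ 2 + 2 * ‖aff (φ ijk)‖ ^ 2) := Finset.sum_le_sum hterm
    _ = 2 * ∑ ijk ∈ box, ‖aff (φ' ijk)‖ ^ 2 + 2 * ∑ ijk ∈ box, ‖aff (φ ijk)‖ ^ 2 := by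
        rw [Finset.sum_add_distrib, Finset.mul_sum, Finset.mul_sum]
    _ ≤ _ := by linarith

/-- **Translations from the local mass**: with `(199/200)·4n + 11/10 ≤ ρ` and `0 ≤ ρ`,
`(2n+1)³ ‖a m‖² ≤ 2 Σ'_p ‖aff p‖² 𝟙[dist p c₀ ≤ ρ] + 2 (2n+1)³ ρ² ‖B‖²`. [folklore] -/
theorem translation_sq_le_localMass (hA : Adm₀ A) (hI : Inner₀ t A)
    {aff : (EuclideanSpace ℝ (Fin 3)) → (EuclideanSpace ℝ (Fin 3))} {a : Fin 2 → EuclideanSpace ℝ (Fin 3)}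
    {B : (EuclideanSpace ℝ (Fin 3)) →L[ℝ] (EuclideanSpace ℝ (Fin 3))} {z₀ : EuclideanSpace ℝ (Fin 3)} (hz₀ : z₀ ∈ Λ₀)
    (haff : ∀ (m : Fin 2) (z : EuclideanSpace ℝ (Fin 3)), z ∈ Λ₀ →
      aff (t m + A z) = a m + B (t m + A z - (t 0 + A z₀)))
    (m : Fin 2) {n : ℕ} {ρ : ℝ} (hρ : 199 / 200 * (4 * n) + 11 / 10 ≤ ρ) :
    ((2 * n + 1) ^ 3 : ℝ) * ‖a m‖ ^ 2 ≤
      2 * (∑' p : Sites₀ t A, ‖aff p‖ ^ 2 * (if dist (p : EuclideanSpace ℝ (Fin 3)) (t 0 + A z₀) ≤ ρ then (1 : ℝ) else 0)) +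
        2 * ((2 * n + 1) ^ 3 : ℝ) * (ρ ^ 2 * ‖B‖ ^ 2) := by
  classical
  set box := (Finset.Icc (-(n : ℤ)) n) ×ˢ (Finset.Icc (-(n : ℤ)) n) ×ˢ (Finset.Icc (-(n : ℤ)) n) with hbox
  set φ : ℤ × ℤ × ℤ → EuclideanSpace ℝ (Fin 3) := fun ijk => t m + A (z₀ + 𝐳[ijk.1, ijk.2.1, ijk.2.2]) with hφ
  have hn0 : (0 : ℝ) ≤ n := Nat.cast_nonneg _
  have hρ0 : 0 ≤ ρ := by linarith
  have hmemS : ∀ ijk ∈ box, φ ijk ∈ Sites₀ t A := fun ijk _ =>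
    ⟨m, _, hcpLiouvilleLam_add_mem hz₀ (latticeVec_mem_Λ₀ _ _ _), rfl⟩
  have hdist : ∀ ijk ∈ box, dist (φ ijk) (t 0 + A z₀) ≤ ρ := by
    intro ijk hijk
    obtain ⟨hi, hj, hk⟩ := mem_box_iff.1 hijk
    have hzn := norm_latticeBox_le hi hj hk
    rw [hφ, dist_eq_norm]
    have : t m + A (z₀ + 𝐳[ijk.1, ijk.2.1, ijk.2.2]) - (t 0 + A z₀) = (t m - t 0) + A 𝐳[ijk.1, ijk.2.1, ijk.2.2] := by
      rw [map_add]; abel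
    rw [this]
    have h1 := norm_apply_le_of_adm₀ hA 𝐳[ijk.1, ijk.2.1, ijk.2.2]
    have h2 : ‖t m - t 0‖ ≤ 11 / 10 := norm_t_sub_t0_le hA hI m
    have h3 := norm_add_le (t m - t 0) (A 𝐳[ijk.1, ijk.2.1, ijk.2.2])
    have h4 : 199 / 200 * ‖𝐳[ijk.1, ijk.2.1, ijk.2.2]‖ ≤ 199 / 200 * (4 * n) := by gcongr
    linarith
  have hinj : Set.InjOn φ box := by
    intro x _ y _ h
    have h' : A (z₀ + 𝐳[x.1, x.2.1, x.2.2]) = A (z₀ + 𝐳[y.1, y.2.1, y.2.2]) := add_left_cancel h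
    have h'' := add_left_cancel (injective_of_adm₀ hA h')
    exact latticeBox_injective h''
  have hterm : ∀ ijk ∈ box, ‖a m‖ ^ 2 ≤ 2 * ‖aff (φ ijk)‖ ^ 2 + 2 * (ρ ^ 2 * ‖B‖ ^ 2) := by
    intro ijk hijk
    have hz : z₀ + 𝐳[ijk.1, ijk.2.1, ijk.2.2] ∈ Λ₀ :=
      hcpLiouvilleLam_add_mem hz₀ (latticeVec_mem_Λ₀ _ _ _)
    have h1 := haff m _ hz
    have ha : a m = aff (φ ijk) - B (φ ijk - (t 0 + A z₀)) := by
      rw [hφ, h1]; abel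
    have hB : ‖B (φ ijk - (t 0 + A z₀))‖ ≤ ρ * ‖B‖ := by
      refine (B.le_opNorm _).trans ?_
      rw [mul_comm, ← dist_eq_norm]
      exact mul_le_mul_of_nonneg_right (hdist ijk hijk) (norm_nonneg _)
    rw [ha]
    have := norm_sub_le (aff (φ ijk)) (B (φ ijk - (t 0 + A z₀)))
    have hρB : 0 ≤ ρ * ‖B‖ := by positivity
    have hle : ‖aff (φ ijk) - B (φ ijk - (t 0 + A z₀))‖ ≤ ‖aff (φ ijk)‖ + ρ * ‖B‖ := by linarith
    have hsq : ‖aff (φ ijk) - B (φ ijk - (t 0 + A z₀))‖ ^ 2 ≤ (‖aff (φ ijk)‖ + ρ * ‖B‖) ^ 2 :=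
      pow_le_pow_left₀ (norm_nonneg _) hle 2
    nlinarith [hsq, sq_nonneg (‖aff (φ ijk)‖ - ρ * ‖B‖)]
  have hS := sum_le_localMass hA hI aff (t 0 + A z₀) ρ box φ hmemS hdist hinj
  calc ((2 * n + 1) ^ 3 : ℝ) * ‖a m‖ ^ 2
      = ∑ ijk ∈ box, ‖a m‖ ^ 2 := by rw [Finset.sum_const, nsmul_eq_mul, hbox, card_latticeBox]; push_cast; ring
    _ ≤ ∑ ijk ∈ box, (2 * ‖aff (φ ijk)‖ ^ 2 + 2 * (ρ ^ 2 * ‖B‖ ^ 2)) := Finset.sum_le_sum hterm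
    _ = 2 * ∑ ijk ∈ box, ‖aff (φ ijk)‖ ^ 2 + ((2 * n + 1) ^ 3 : ℝ) * (2 * (ρ ^ 2 * ‖B‖ ^ 2)) := by
        rw [Finset.sum_add_distrib, Finset.mul_sum, Finset.sum_const, nsmul_eq_mul, hbox, card_latticeBox]
        push_cast; ring
    _ ≤ _ := by nlinarith [sq_nonneg ρ, norm_nonneg B]

/-- **Norm equivalence for affine fields on site balls.**  For an affine field `aff` with translations
`a 0, a 1`, linear part `B` and centre a site `c₀ = t 0 + A z₀`, and a radius `ρ ≥ 16`,
`ρ²‖B‖² + ‖a 0‖² + ‖a 1‖² ≤ 2³³/ρ³ · Σ'_p ‖aff p‖² 𝟙[dist p c₀ ≤ ρ]`: the sup-type size of an affine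
field on the ball is controlled by its `ℓ²`-average there (box `n = ⌊ρ/8⌋`, shifts by `n` steps along
`u₁, u₂, w₃`). [folklore] -/
theorem affine_coeff_sq_le_localMass (hA : Adm₀ A) (hI : Inner₀ t A)
    {aff : (EuclideanSpace ℝ (Fin 3)) → (EuclideanSpace ℝ (Fin 3))} {a : Fin 2 → EuclideanSpace ℝ (Fin 3)}
    {B : (EuclideanSpace ℝ (Fin 3)) →L[ℝ] (EuclideanSpace ℝ (Fin 3))} {z₀ : EuclideanSpace ℝ (Fin 3)} (hz₀ : z₀ ∈ Λ₀)
    (haff : ∀ (m : Fin 2) (z : EuclideanSpace ℝ (Fin 3)), z ∈ Λ₀ →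
      aff (t m + A z) = a m + B (t m + A z - (t 0 + A z₀)))
    {ρ : ℝ} (hρ : 16 ≤ ρ) :
    ρ ^ 2 * ‖B‖ ^ 2 + ‖a 0‖ ^ 2 + ‖a 1‖ ^ 2 ≤
      2 ^ 33 / ρ ^ 3 * ∑' p : Sites₀ t A, ‖aff p‖ ^ 2 * (if dist (p : EuclideanSpace ℝ (Fin 3)) (t 0 + A z₀) ≤ ρ then (1 : ℝ) else 0) := by
  set mass := ∑' p : Sites₀ t A, ‖aff p‖ ^ 2 *
    (if dist (p : EuclideanSpace ℝ (Fin 3)) (t 0 + A z₀) ≤ ρ then (1 : ℝ) else 0) with hmass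
  have hmass0 : 0 ≤ mass := tsum_nonneg fun p => by positivity
  have hρ0 : 0 < ρ := by linarith
  set n := ⌊ρ / 8⌋₊ with hn
  have hn_le : (n : ℝ) ≤ ρ / 8 := Nat.floor_le (by positivity)
  have hn_gt : ρ / 8 - 1 < n := by
    have := Nat.lt_floor_add_one (ρ / 8)
    rw [← hn] at this
    linarith
  have hn1 : (1 : ℝ) ≤ n := by linarith
  have hn0 : (0 : ℝ) ≤ n := by linarith
  -- the two counting factors
  have hP : (ρ / 8) ^ 3 ≤ ((2 * n + 1) ^ 3 : ℝ) := pow_le_pow_left₀ (by positivity) (by linarith) 3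
  have hQ : (ρ / 16) ^ 2 ≤ (n : ℝ) ^ 2 := pow_le_pow_left₀ (by positivity) (by linarith) 2
  have hP' : ((2 * n + 1) ^ 3 : ℝ) ≤ ρ ^ 3 / 32 := by
    have h1 : (2 * n + 1 : ℝ) ≤ 5 * ρ / 16 := by linarith
    calc ((2 * n + 1) ^ 3 : ℝ) ≤ (5 * ρ / 16) ^ 3 := pow_le_pow_left₀ (by positivity) h1 3
      _ = 125 / 4096 * ρ ^ 3 := by ring
      _ ≤ ρ ^ 3 / 32 := by linarith [pow_pos hρ0 3]
  obtain ⟨hu1, hu2, hw3⟩ := norm_generators_le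
  -- generator estimates
  have key : ∀ τ : EuclideanSpace ℝ (Fin 3), τ ∈ Λ₀ → ‖τ‖ ≤ 2 → ρ ^ 5 * ‖B (A τ)‖ ^ 2 ≤ 2 ^ 19 * mass := by
    intro τ hτ hτ2
    have hcond : 199 / 200 * (4 * n + n * ‖τ‖) ≤ ρ := by
      have : (n : ℝ) * ‖τ‖ ≤ n * 2 := by gcongr
      linarith
    have h := lattice_image_sq_le_localMass hA hI hz₀ haff hτ (n := n) (N := n) hcond
    rw [norm_smul, Real.norm_eq_abs, abs_of_nonneg hn0, mul_pow] at h
    calc ρ ^ 5 * ‖B (A τ)‖ ^ 2 = 2 ^ 17 * ((ρ / 8) ^ 3 * (ρ / 16) ^ 2) * ‖B (A τ)‖ ^ 2 := by ring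
      _ ≤ 2 ^ 17 * (((2 * n + 1) ^ 3 : ℝ) * (n : ℝ) ^ 2) * ‖B (A τ)‖ ^ 2 := by gcongr
      _ = 2 ^ 17 * (((2 * n + 1) ^ 3 : ℝ) * ((n : ℝ) ^ 2 * ‖B (A τ)‖ ^ 2)) := by ring
      _ ≤ 2 ^ 17 * (4 * mass) := by gcongr
      _ = 2 ^ 19 * mass := by ring
  have k1 := key _ triangularVec₁_mem_Λ₀ hu1
  have k2 := key _ triangularVec₂_mem_Λ₀ hu2
  have k3 := key _ layerNormal_two_mem_Λ₀ hw3
  -- the linear part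
  have hB := opNorm_le_of_lattice_images hA B
  have hBsq : ‖B‖ ^ 2 ≤ 11 * (‖B (A 𝐮₁)‖ ^ 2 + ‖B (A 𝐮₂)‖ ^ 2 + ‖B (A 𝐰₃)‖ ^ 2) := by
    have h0 : 0 ≤ ‖B‖ := norm_nonneg _
    have h1 := pow_le_pow_left₀ h0 hB 2
    refine h1.trans ?_
    have hcs : (2 * ‖B (A 𝐮₁)‖ + 2 * ‖B (A 𝐮₂)‖ + ‖B (A 𝐰₃)‖) ^ 2 ≤
        9 * (‖B (A 𝐮₁)‖ ^ 2 + ‖B (A 𝐮₂)‖ ^ 2 + ‖B (A 𝐰₃)‖ ^ 2) := by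
      nlinarith [sq_nonneg (‖B (A 𝐮₁)‖ - ‖B (A 𝐮₂)‖), sq_nonneg (‖B (A 𝐮₁)‖ - 2 * ‖B (A 𝐰₃)‖),
        sq_nonneg (‖B (A 𝐮₂)‖ - 2 * ‖B (A 𝐰₃)‖)]
    rw [mul_pow]
    have h9 : 0 ≤ ‖B (A 𝐮₁)‖ ^ 2 + ‖B (A 𝐮₂)‖ ^ 2 + ‖B (A 𝐰₃)‖ ^ 2 := by positivity
    nlinarith
  have hB5 : ρ ^ 5 * ‖B‖ ^ 2 ≤ 2 ^ 25 * mass := by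
    have h1 := mul_le_mul_of_nonneg_left hBsq (by positivity : (0 : ℝ) ≤ ρ ^ 5)
    have h2 : ρ ^ 5 * (11 * (‖B (A 𝐮₁)‖ ^ 2 + ‖B (A 𝐮₂)‖ ^ 2 + ‖B (A 𝐰₃)‖ ^ 2)) =
        11 * (ρ ^ 5 * ‖B (A 𝐮₁)‖ ^ 2 + ρ ^ 5 * ‖B (A 𝐮₂)‖ ^ 2 + ρ ^ 5 * ‖B (A 𝐰₃)‖ ^ 2) := by ring
    rw [h2] at h1
    linarith
  -- the translations
  have hcondT : 199 / 200 * (4 * n) + 11 / 10 ≤ ρ := by linarith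
  have hT : ∀ m : Fin 2, ρ ^ 3 * ‖a m‖ ^ 2 ≤ (2 ^ 30 + 2 ^ 10) * mass := by
    intro m
    have h := translation_sq_le_localMass hA hI hz₀ haff m hcondT
    rw [← hmass] at h
    have hPpos : (0 : ℝ) < (2 * n + 1) ^ 3 := by positivity
    -- ρ³ ≤ 512 (2n+1)³
    have h512 : ρ ^ 3 ≤ 512 * ((2 * n + 1) ^ 3 : ℝ) := by
      have : ρ ^ 3 = 512 * (ρ / 8) ^ 3 := by ring
      rw [this]; gcongr
    have ha0 : 0 ≤ ‖a m‖ ^ 2 := sq_nonneg _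
    have h' := mul_le_mul_of_nonneg_left h (by norm_num : (0 : ℝ) ≤ 512)
    calc ρ ^ 3 * ‖a m‖ ^ 2 ≤ 512 * ((2 * n + 1) ^ 3 : ℝ) * ‖a m‖ ^ 2 := by gcongr
      _ = 512 * (((2 * n + 1) ^ 3 : ℝ) * ‖a m‖ ^ 2) := by ring
      _ ≤ 512 * (2 * mass + 2 * ((2 * n + 1) ^ 3 : ℝ) * (ρ ^ 2 * ‖B‖ ^ 2)) := h'
      _ = 1024 * mass + 1024 * (((2 * n + 1) ^ 3 : ℝ) * ρ ^ 2) * ‖B‖ ^ 2 := by ring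
      _ ≤ 1024 * mass + 1024 * (ρ ^ 3 / 32 * ρ ^ 2) * ‖B‖ ^ 2 := by gcongr
      _ = 1024 * mass + 32 * (ρ ^ 5 * ‖B‖ ^ 2) := by ring
      _ ≤ 1024 * mass + 32 * (2 ^ 25 * mass) := by gcongr
      _ = (2 ^ 30 + 2 ^ 10) * mass := by ring
  have hT0 := hT 0
  have hT1 := hT 1
  -- assemble (multiply through by ρ³)
  have hρ3 : 0 < ρ ^ 3 := by positivity
  have hsum : (ρ ^ 2 * ‖B‖ ^ 2 + ‖a 0‖ ^ 2 + ‖a 1‖ ^ 2) * ρ ^ 3 ≤ 2 ^ 33 * mass := by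
    have e : (ρ ^ 2 * ‖B‖ ^ 2 + ‖a 0‖ ^ 2 + ‖a 1‖ ^ 2) * ρ ^ 3 =
        ρ ^ 5 * ‖B‖ ^ 2 + ρ ^ 3 * ‖a 0‖ ^ 2 + ρ ^ 3 * ‖a 1‖ ^ 2 := by ring
    rw [e]
    linarith
  calc ρ ^ 2 * ‖B‖ ^ 2 + ‖a 0‖ ^ 2 + ‖a 1‖ ^ 2
      = (ρ ^ 2 * ‖B‖ ^ 2 + ‖a 0‖ ^ 2 + ‖a 1‖ ^ 2) * ρ ^ 3 / ρ ^ 3 := by field_simp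
    _ ≤ 2 ^ 33 * mass / ρ ^ 3 := by gcongr
    _ = 2 ^ 33 / ρ ^ 3 * mass := by ring

end Affine

end Summit.AtomisticToContinuum.Crystallization.Theorems.ExcessDecayLiouville

end
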